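import Summits.CriticalPhenomena.CardyFormulaZ2.Theses.CardyBondTriangular
import Summits.CriticalPhenomena.CardyFormulaZ2.Theorems.CardyBondTriangularSwitchingReductionFromSwitching
import Summits.CriticalPhenomena.CardyFormulaZ2.Theorems.CardyBondTriangularSeparatingDataToCardy
import Summits.CriticalPhenomena.CardyFormulaZ2.Theorems.CardyBondTriangularBondTriangularCardyWeakAssembly
import Summits.CriticalPhenomena.CardyFormulaZ2.Theorems.CardyBondTriangularBondTriangularCardyStubThreeArmSmall
import Summits.CriticalPhenomena.CardyFormulaZ2.Theorems.CardyBondTriangularBondTriangularCardyStubWeakBoundaryUpgrade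
import Summits.CriticalPhenomena.CardyFormulaZ2.Theorems.CardyBondTriangularBondTriangularCardyStubOfAnticlockwise
import Summits.CriticalPhenomena.CardyFormulaZ2.Theorems.CardyBondTriangularBondTriangularCardyEquicontinuityOfBlueArm
import Summits.CriticalPhenomena.CardyFormulaZ2.Theorems.CardyBondTriangularBondTriangularCardyDiscreteDomainsOfParts
import Summits.CriticalPhenomena.CardyFormulaZ2.Theorems.CardyBondTriangularBondTriangularCardyStubSeparatesOfIsPath
import Summits.CriticalPhenomena.CardyFormulaZ2.Theorems.CardyBondTriangularBondTriangularCardyStubCorner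
import Summits.CriticalPhenomena.CardyFormulaZ2.Theorems.CardyBondTriangularBondTriangularCardyStubClDuality
import Summits.CriticalPhenomena.CardyFormulaZ2.Theorems.CardyBondTriangularBondTriangularCardyStubBlueArm
import Summits.CriticalPhenomena.CardyFormulaZ2.Theorems.CardyBondTriangularBondTriangularCardyUpperOfCofill
import Summits.CriticalPhenomena.CardyFormulaZ2.Theorems.CardyBondTriangularBondTriangularCardyStubCofillGeometry
import Summits.CriticalPhenomena.CardyFormulaZ2.Theorems.CardyBondTriangularBondTriangularCardyStubYellowCrossingOfCrude

/-!
# Crux `BondTriangularCardy` (stmt-CriticalPhenomena-4664) — birth skeleton (`Lines/birth.lean`)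

Route `CardyBondTriangular` (sub-problem `CardyFormulaZ2`), crux
`Summit.CriticalPhenomena.CardyFormulaZ2.Theses.CardyBondTriangular.BondTriangularCardy`:
Cardy's formula for canonical bond percolation on the triangular lattice `𝕋`
(`p = criticalWeightI (π/6) = 2 sin(π/18)`), crude discretisation `embDomainCrossing`, embedding
`z x = √3 (triEmbed x − (1+ζ)/3)`, for every conformal rectangle.

The skeleton is Bollobás–Riordan's proof of Smirnov's theorem (Percolation, CUP 2006, Ch. 7
§7.2.4–7.2.6) run on the Chayes–Lei hexagon representation of bond-𝕋
(`ChayesLeiHexPercolation.triBondCritical`, separating probabilities `clSepProb`,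
`clSepDiffProb`), i.e. the route's own TWO-LAYER PLAN
`BondTriangularCardy ⇐ MesoscopicColourSwitching ∧ SwitchingReduction`, cut along the seams of
the tree's PROVED site-𝕋 proof (`tri_exists_discreteApprox`, `tri_sepProb_sub_le_of_dualPath`,
`tri_sepProb_boundary_tendsto`, `tri_openCrossingProb_approx_sepProb`,
`smirnov_exists_separatingData_of_anticlockwise`) and composed through the route's landed
support theorems `exists_separatingData_triBond_of_mesoscopicColourSwitching`
(`SwitchingReduction`, bookkeeping half) and `separatingDataToCardy_proof`
(`SeparatingDataToCardy`, stmt-4666):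

* `stub_mesoscopicColourSwitching` — the route's rank-2 crux `MesoscopicColourSwitching`
  (stmt-CriticalPhenomena-5003) BY NAME: Bollobás–Riordan's colour switching (14) for bond-𝕋 with
  a summed defect `o(n δ)`; the load-bearing stub (open).
* `stub_threeArmSmall` — (12) p. 181 on compacta: the differences `hⁱ_δ(w, z_j)` of the
  Chayes–Lei separating probabilities of any discrete approximation are `≤ ε_K(δ) → 0` on the
  faces of a compact `K ⊆ Ω` (one-arm RSW bound for critical bond-𝕋 + the pivotal-bond
  combinatorics of `clSepEvent`). [M]
* `stub_equicontinuity` — the estimate of the proof of Claim 22 (p. 198) for `clSepProb` of any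
  discrete approximation, qualitative format (Claim 10-type duality for the CL representation +
  primal AND dual one-arm bounds). [L]
* `stub_discreteDomains` — Lemma 14 (p. 184) for bond-𝕋 with an anticlockwise Carleson datum:
  inner/outer discrete approximations `G∓` (`IsDiscreteApprox`, geometry reusable from
  `tri_exists_discreteApprox_proof`) carrying the boundary values of pp. 200–201 for `clSepProb`
  and faces `z∓_δ → d'` with the sandwich (19)+(40) of the crude bond-𝕋 crossing probability at
  mesh `δ/√3` between `f⁻¹_δ(z⁻_δ) - e(δ)` and `f⁺¹_δ(z⁺_δ) + e(δ)` (RSW, exact 𝕋/hexagonal duality,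
  star–triangle self-duality at `2 sin(π/18)` = `isSelfDual_triBondCritical`). [L/XL]
* `stub_ofAnticlockwise` — the datum-wise hypothesis of `SeparatingDataToCardy` for all Carleson
  data from the anticlockwise ones: the bond-𝕋 analogue of
  `smirnov_exists_separatingData_of_anticlockwise` (the embedded lattice
  `√3 (𝕋 − (1+ζ)/3)` is invariant under the reflection `z ↦ -z̄`, NOT under `conj`). [M, provable now]

`BondTriangularCardy_of` composes them (no `sorry`): for an anticlockwise datum,
`stub_discreteDomains` gives `G∓`, boundary values and the sandwich, `stub_threeArmSmall` /
`stub_equicontinuity` the interior inputs, and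
`exists_separatingData_triBond_of_mesoscopicColourSwitching` (with the crux
`stub_mesoscopicColourSwitching`) the separating data; `stub_ofAnticlockwise` removes the
orientation hypothesis and `separatingDataToCardy_proof` concludes the crux BY NAME.

LANDED stubs (imported, used directly in the composition): stub_threeArmSmall (p151159), stub_weakBoundaryUpgrade (p151132), stub_ofAnticlockwise (p151235).
LANDED (v4): stub_separatesOfIsPath (p154664), stub_corner (p155664; owns Sig.stub_clDuality), stub_clDuality (p158481, kite toolkit), stub_blueArm (p159275; owns Sig.stub_blueArm; KiteB toolkit, Claim 10 port).
Reshape v5 (~12:40Z): the upper half of the sandwich no longer goes through duality + "no sneaking" (the registered v4 stub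
`stub_sandwichUpper` reduced, by the landed `sandwichUpper_of_noSneak` p157472, to `PartSig.noSneak`, which is NOT derivable from
one-arm bounds: a blue stretch-1→3 crossing of an ARBITRARY shorter–fatter `G⁺` can end in a lattice-scale dent beyond the crude
path); instead, as in Bollobás–Riordan's own proof of (19) (Claims 19–20 p. 192), the CONSTRUCTED `G⁺` is cofilled
(`stub_cofillGeometry`: every hexagon within 2δ of Ω, ρ-far from the corners and κ-far from A₀ ∪ A₂ is a site; ρ-far sites are
> 2δ from A₀ ∪ A₂), and then an open crude crossing deterministically contains a yellow stretch-0→2 crossing of `G⁺` or a yellow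
corner arm (`stub_yellowCrossingOfCrude`); the assembly `discreteDomains_of_cofill` (…CardyUpperOfCofill.lean, lead) is landed.
Skeleton v6 (~13:05Z): wave 3 LANDED both v5 stubs — `stub_cofillGeometry` (p160657; helper CofillLevel p160267) and
`stub_yellowCrossingOfCrude` (p160637; helpers YellowOfCrudeChain p160245, YellowOfCrudeRuns p160246). The ONLY remaining `sorry` is
`stub_mesoscopicColourSwitching` (= item stmt-CriticalPhenomena-5003, open problem in print); RSW (`BondTriangularBoxCrossing`, item 7023)
is a by-name hypothesis. The sorry-free composition is landed as the tree theorem `bondTriangularCardy_of_switching :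
MesoscopicColourSwitching → BondTriangularBoxCrossing → BondTriangularCardy` (…CardyOfSwitching.lean).
Reshape v4 (~10:00Z): `stub_equicontinuity` and `stub_discreteDomains` are THEOREMS over the finer stubs `stub_blueArm`
(Claim 10 blue arm), `stub_clDuality` (CL Lemma 5), `stub_separatesOfIsPath`, `stub_corner`, `stub_sandwichUpper`, via the landed
reductions `equicontinuity_of_blueArm` (p152426), `discreteDomains_of_parts` (p152434), `clYellowAnnulus_small_of_boxCrossing`
(p151986); `stub_boxCrossing` is no longer a separate sorry (RSW = route item `BondTriangularBoxCrossing` stays a BY-NAME hypothesis).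

Reshape v2 (line lead prover-line-stmt-CriticalPhenomena-4664-0, 2026-08-17): the RSW input of Stubs 2–4 is
isolated as the named stub `stub_boxCrossing` (= route item stmt-CriticalPhenomena-7023
`BondTriangularBoxCrossing`, unproved in the tree, GM2013 in print); Stubs 2–4 take it as their
hypothesis; the composition is unchanged otherwise.

Disproof used: none on file for this crux (`ledger crux ls stmt-CriticalPhenomena-4664`: no
`Disproof.lean`, no Negative lemmas at registration, 2026-08-17).
-/

noncomputable section

namespace Summit.CriticalPhenomena.CardyFormulaZ2.Theorems.BondTriangularCardyLine

open Set Filter Topology Metric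
open Literature.Probability.Percolation Literature.Probability.RandomPlanarGeometry
open Literature.Probability.RandomPlanarGeometry.MarkedDomain
open Literature.Probability.LatticeModels
open Summit.CriticalPhenomena.CardyFormulaZ2.Theorems

/-! ### Stub signatures (named, so that the composition's hypotheses are the stubs BY NAME) -/

/-- Unconditional core of Stub 3 (`Sig.equicontinuity`; the registered signature `Sig.stub_equicontinuity` is this from RSW): the equicontinuity estimate of p. 198 for critical bond-𝕋 (proof of Claim 22), in
the qualitative format consumed by `exists_separatingData_triBond_of_mesoscopicColourSwitching`: for
any discrete approximation `G` of `R` and `β > 0` there is `γ > 0` such that, eventually,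
`fⁱ_δ(z) - fⁱ_δ(w) ≤ β` whenever the face `z` is reached from the triangle `w` of `G_δ` by a dual
chain of triangles of `G_δ` inside `B_{2γ}(w)`. Why plausibly true: the bond-𝕋 analogue of the
tree's PROVED `tri_sepProb_sub_le_of_dualPath` — `Eⁱ(z) ∖ Eⁱ(w)` forces a primal arm (to
`A_{i+1}`/`A_{i+2}`) or, by exact 𝕋/hexagonal duality in the CL representation, a dual (blue) arm
to `Aᵢ`, across the annulus `A(w; 3γ, c/2)` ((35)); primal and dual one-arm RSW bounds. [cite: BollobasRiordan2006, Ch. 7 proof of Claim 22 p. 198, (35) p. 197; ChayesLei2007, §2.1–2.3] -/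
def Sig.equicontinuity : Prop :=
    ∀ (R : Literature.Probability.RandomPlanarGeometry.ConformalRectangle) (G : ℝ → Literature.Probability.Percolation.TriMarkedDomain 4), Literature.Probability.Percolation.IsDiscreteApprox R G →
      ∀ β > (0 : ℝ), ∃ γ > (0 : ℝ), ∀ᶠ δ : ℝ in 𝓝[>] 0, ∀ (i : Fin 3) (w z : Literature.Probability.LatticeModels.HexVertex),
        w ∈ (G δ).faces → Relation.ReflTransGen (fun x y : Literature.Probability.LatticeModels.HexVertex => Literature.Probability.LatticeModels.hexGraph.Adj x y ∧
          y ∈ (G δ).faces ∧ dist ((δ : ℂ) * Literature.Probability.LatticeModels.hexCenter w) ((δ : ℂ) * Literature.Probability.LatticeModels.hexCenter y) < 2 * γ) w z →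
          (G δ).dropLast.clSepProb Literature.Probability.Percolation.ChayesLeiHexPercolation.triBondCritical i z -
            (G δ).dropLast.clSepProb Literature.Probability.Percolation.ChayesLeiHexPercolation.triBondCritical i w ≤ β

/-! ### Stub signatures after reshape v2 (line lead, 2026-08-17): Stubs 2–4 take RSW for bond-𝕋 as hypothesis

The head constant of each stub hypothesis of `BondTriangularCardy_of` must carry the stub's name
(`Sig.stub_X`), so the RSW-conditional signatures are the `Sig.stub_X` and the unconditional
percolation statements they wrap are `Sig.threeArmSmall`, `Sig.equicontinuity`, `Sig.discreteDomains`. -/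

/-- Signature of `stub_equicontinuity` (reshape v2): the p. 198 equicontinuity estimate for critical bond-𝕋,
`Sig.equicontinuity`, from the box-crossing property (route item `BondTriangularBoxCrossing`, BY NAME). [cite: BollobasRiordan2006, Ch. 7 proof of Claim 22 p. 198; GrimmettManolescuAOP2013, §1.3 main theorem (b)] -/
def Sig.stub_equicontinuity : Prop :=
    Summit.CriticalPhenomena.CardyFormulaZ2.Theses.CardyBondTriangular.BondTriangularBoxCrossing → Sig.equicontinuity

/-! ### Weak separating data, the upgrade stub's signature and the weak assembly: LANDED
(`Theorems/CardyBondTriangularBondTriangularCardyWeakAssembly.lean`, p149652; imported). -/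

/-! ### Stub signatures of reshapes v4/v5: all LANDED and imported (`Sig.stub_blueArm` in …StubBlueArm, `Sig.stub_clDuality` in
…StubCorner, `Sig.stub_cofillGeometry` / `Sig.stub_yellowCrossingOfCrude` in …CofillCore) -/

/-! ### The stubs (reshape v2 by the line lead, 2026-08-17: RSW isolated as a named stub) -/

/-- **Stub 1 (load-bearing; = route item stmt-CriticalPhenomena-5003 `MesoscopicColourSwitching`, rank 2, BY NAME).**
Bollobás–Riordan's colour-switching identity (14) for the Chayes–Lei separating probabilities of
critical bond-𝕋, with a signed weighted defect summed over the faces inside any lattice triangular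
contour in a compact `K ⊆ Ω` of size `≤ n δ e(δ)`, `e → 0`. Open (the route's bet: exact switching
fails microscopically on bond-𝕋, a mesoscopic rate is conjectured). [cite: BollobasRiordan2006, Ch. 7 Lemma 12 p. 180, (14) p. 181] -/
theorem stub_mesoscopicColourSwitching :
    Summit.CriticalPhenomena.CardyFormulaZ2.Theses.CardyBondTriangular.MesoscopicColourSwitching := by
  sorry


/-- **stub_equicontinuity (v4/v5: a THEOREM, fully landed)** — by the landed `equicontinuity_of_blueArm` (p152426) and the landed `stub_blueArm` (p159275). -/
theorem stub_equicontinuity : Sig.stub_equicontinuity := fun hRSW =>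
  Summit.CriticalPhenomena.CardyFormulaZ2.Theorems.equicontinuity_of_blueArm stub_blueArm hRSW

/-- **stub_discreteDomains (v6: a THEOREM, fully landed)** — by the landed `discreteDomains_of_cofill` (p159486) over the landed
stubs `stub_cofillGeometry` (p160657) and `stub_yellowCrossingOfCrude` (p160637), the landed yellow arm bound
`clYellowAnnulus_small_of_boxCrossing` (p151986) and the landed corner normalisation `stub_corner stub_clDuality stub_separatesOfIsPath`
(p155664, p158481, p154664). -/
theorem stub_discreteDomains : Sig.stub_discreteDomains :=
  discreteDomains_of_cofill stub_cofillGeometry stub_yellowCrossingOfCrude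
    Summit.CriticalPhenomena.CardyFormulaZ2.Theorems.clYellowAnnulus_small_of_boxCrossing
    (stub_corner stub_clDuality stub_separatesOfIsPath)

/-! ### The composition (sorry-free): the open stubs (by name) and the landed ones give the crux BY NAME -/

/-- **The composition (kernel-checked, no `sorry`): the seven stubs imply the crux BY NAME (reshape v3).**
For an anticlockwise Carleson datum, Stub 4 (fed with RSW, Stub 1b) gives `G∓`, the boundary values
and the sandwich; Stubs 2–3 (fed with RSW) the interior inputs for `G⁻` and `G⁺`; the crux
`MesoscopicColourSwitching` (Stub 1) and `exists_separatingData_triBond_of_mesoscopicColourSwitching`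
then give the separating data with `ω = ζ² = triangleTurn a b c`; Stub 5 removes the orientation
hypothesis, and `separatingDataToCardy_proof` (item `SeparatingDataToCardy`, stmt-4666, proved)
concludes. -/
theorem BondTriangularCardy_of :
    Summit.CriticalPhenomena.CardyFormulaZ2.Theses.CardyBondTriangular.MesoscopicColourSwitching →
    Summit.CriticalPhenomena.CardyFormulaZ2.Theses.CardyBondTriangular.BondTriangularBoxCrossing →
    Summit.CriticalPhenomena.CardyFormulaZ2.Theses.CardyBondTriangular.BondTriangularCardy := by
  intro h14 hrsw
  have h12 := stub_threeArmSmall hrsw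
  have h198 := stub_equicontinuity hrsw
  have hdom := stub_discreteDomains hrsw
  refine separatingDataToCardy_proof (stub_ofAnticlockwise ?_)
  intro R a b c d ψ habc hd hψ hturn
  obtain ⟨Gm, Gp, hGm, hGp, h200m, hcm, h200p, hcp, zm, zp, e, hzm, hzp, hztm, hztp, he, hsand⟩ :=
    hdom R a b c d ψ habc hd hψ hturn
  rw [hturn]
  exact exists_separatingData_triBond_of_mesoscopicColourSwitching_weak stub_weakBoundaryUpgrade h14 hGm hGp
    (h12 R Gm hGm) (h198 R Gm hGm) h200m hcm (h12 R Gp hGp) (h198 R Gp hGp) h200p hcp hzm hzp hztm hztp he hsand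

end Summit.CriticalPhenomena.CardyFormulaZ2.Theorems.BondTriangularCardyLine

end
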